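import Mathlib
import HarnessLib

/-!
# Crux `UVSeamRec` (stmt-QuantumFields-20043), hypothesis (b) of the defect collar: a chessboard-type bound on an
# ODD cycle WITHOUT block divisibility — part I, the extremal reduction

Helper file (`--supports stmt-QuantumFields-20043`, count-neutral) of seat `ym-infvol-p3` g10.  HONEST FRAMING:
reflection-positivity bookkeeping on a finite odd torus; nothing about the universal (free-energy) bound, weak coupling,
E0′, the gap, or Clay is asserted.

CONTEXT.  The stub seat `ym-20043-seam-s2` located (CEILINGS note rev 2, §5) that the multiplicative rarity consumed by
`momentBounds6_of_goodLaw_and_rarity` (hypothesis (b)) is a chessboard statement over BLOCKS of width `w ≍ 2R+3`, and that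
the Fröhlich–Israel–Lieb–Simon chessboard estimate needs a tiling of the torus side `M` by equal blocks, `w ∣ M` — fine on
the family sides `2·L₀ⁿ` and on odd classes `{L₀ⁿ}`, impossible at PRIME sides, which the all-odd-sides currency
`MomentBounds6` includes.  This file is the first half of a located correction in ONE direction: on the cycle `ℤ/(2S+1)`
with slab events of width `w` at ARBITRARY positions, reflection positivity alone forces the chessboard bound, the dense
(«all blocks bad») configurations of the tiling being replaced by the dense configurations of the cycle.

SETTING (abstract, §1).  A finite type `α` of «slab positions», a type `μ` of «moves» (reflections), for each move a
validity predicate `valid m A` and the two symmetrisations `sP m A`, `sM m A` of a configuration `A : Finset α` with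
`#(sP m A) + #(sM m A) = 2 · #A`, and a set function `p ≥ 0` obeying the reflection Cauchy–Schwarz inequalities
`p A ^ 2 ≤ p (sP m A) · p (sM m A)` at valid moves.  `Reaches valid sP sM A` is the inductive statement «the empty
configuration is reachable from `A` through symmetrisations at valid moves».

RESULT (§1, `le_pow_card_of_reaches`).  If every «good» non-empty configuration that is not «dense» reaches `∅`, and
`p D ≤ λ ^ #D` on dense good `D` (`λ > 0`), then `p A ≤ λ ^ #A` for EVERY good `A`.  Proof = the FILS maximisation argument
(CMP 62 (1978), proof of Thm. 2.2): a maximiser of `Φ A = p A / λ ^ #A` stays a maximiser under both symmetrisations of a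
valid move, hence along a reachability chain down to `∅`, where `Φ = p ∅ ≤ 1`.

CONCRETE ODD CYCLE (§2).  `α = μ = ℤ/(2S+1)` (slab `a` = layers `a, …, a+w-1`; move `x` = the reflection `y ↦ 2x − y`
fixing the site hyperplane `x` and the link hyperplane `(x+S, x+S+1)`); `InPlus w x a` = the slab lies in the CLOSED half
`[x, x+S]`, `InMinus w x a` = it lies in the closed half `[x+S+1, x]`; `Valid w A x` = every slab of `A` lies in one of
the two halves (no slab is cut by either hyperplane — the usable reflections of an odd torus); `refl w x a = 2x+1−w−a`
(start of the mirrored slab); `symP`/`symM`; `Compatible w A` = distinct slabs are disjoint or share one boundary layer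
(`w − 1 ≤ (b − a).val`).  We prove the card identity, that both symmetrisations of a compatible configuration at a valid
move are compatible, that a configuration inside one closed half reaches `∅` in one move, and assemble
`le_pow_card_of_reachesOddCycle`: the chessboard bound on the odd cycle GIVEN the reachability of `∅` from every
non-dense compatible configuration.  That reachability (a finite combinatorial statement: «every compatible `A` with
`(4w−5)·#A < 2(2S+1)` reaches `∅`», verified exhaustively for all odd sides `≤ 47`, `3 ≤ w ≤ 7`, and proved on paper by
the potential `(#A ↓, Σ gap² ↑)` — note `PRIME-SIDE-CHESSBOARD.md` of the seat) is part II, NOT in this file.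

What is NOT here: measure theory (the Schwarz inequalities are hypotheses — for the Wilson action on odd tori they are the
tree's `Theorems/BalabanLadderIROddTorusWeightedRP.lean`), the `d`-dimensional block version (open: FILS's iteration
over axes does not transfer to prime sides), the universal bound.

References: J. Fröhlich, R. Israel, E. H. Lieb, B. Simon, Commun. Math. Phys. 62 (1978) 1–34 (Thm. 2.2, maximisation
proof); S. Friedli, Y. Velenik, *Statistical Mechanics of Lattice Systems* (CUP 2017) Thm. 10.11 and Remark 10.4
(«we will always assume L to be even»); M. Biskup, LNM 1970 (2009) §5.
-/

set_option autoImplicit false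

noncomputable section

open Finset

namespace Summit.QuantumFields.YangMills.Theorems.OddCycleChessboard

/-! ## §1 The abstract extremal reduction: reachability of `∅` ⇒ the chessboard bound -/

section Abstract

variable {α μ : Type*}

/-- **Reachability of the empty configuration.**  `Reaches valid sP sM A`: starting from the configuration `A`, a finite
chain of symmetrisations (`sP m ·` or `sM m ·` at moves `m` valid for the current configuration) arrives at `∅`
(this file's bookkeeping device for the maximisation argument). [folklore] -/
inductive Reaches (valid : μ → Finset α → Prop) (sP sM : μ → Finset α → Finset α) : Finset α → Prop
  /-- the empty configuration is reached -/
  | empty : Reaches valid sP sM ∅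
  /-- a positive symmetrisation at a valid move, then continue -/
  | plus {A : Finset α} (m : μ) (hv : valid m A) (h : Reaches valid sP sM (sP m A)) : Reaches valid sP sM A
  /-- a negative symmetrisation at a valid move, then continue -/
  | minus {A : Finset α} (m : μ) (hv : valid m A) (h : Reaches valid sP sM (sM m A)) : Reaches valid sP sM A

/-- The FILS ratio `Φ A = p A / λ ^ #A`. -/
def phi (p : Finset α → ℝ) (lam : ℝ) (A : Finset α) : ℝ := p A / lam ^ #A

/-- `Φ ∅ = p ∅`. -/
theorem phi_empty (p : Finset α → ℝ) (lam : ℝ) : phi p lam ∅ = p ∅ := by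
  simp [phi]

/-- `Φ ≥ 0` where `p ≥ 0` (`λ > 0`). -/
theorem phi_nonneg {p : Finset α → ℝ} {lam : ℝ} (hlam : 0 < lam) {A : Finset α} (h0 : 0 ≤ p A) :
    0 ≤ phi p lam A :=
  div_nonneg h0 (pow_nonneg hlam.le _)

/-- **Cauchy–Schwarz passes to `Φ`**: `Φ A ^ 2 ≤ Φ (sP m A) · Φ (sM m A)` as soon as
`p A ^ 2 ≤ p (sP m A) · p (sM m A)` and `#(sP m A) + #(sM m A) = 2 · #A`. -/
theorem phi_sq_le {p : Finset α → ℝ} {lam : ℝ} (hlam : 0 < lam) {A P N : Finset α}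
    (hcs : p A ^ 2 ≤ p P * p N) (hcard : #P + #N = 2 * #A) :
    phi p lam A ^ 2 ≤ phi p lam P * phi p lam N := by
  have hden : lam ^ #P * lam ^ #N = (lam ^ #A) ^ 2 := by
    rw [← pow_add, hcard, pow_mul']
  simp only [phi, div_pow]
  rw [div_mul_div_comm, hden]
  exact div_le_div_of_nonneg_right hcs (by positivity)

/-- **Both symmetrisations of a maximiser are maximisers.**  If `Φ ≤ Mx` on a class containing `P` and `N`, `0 < Mx`,
`Φ A = Mx`, `Φ P, Φ N ≥ 0` and `Φ A ^ 2 ≤ Φ P · Φ N`, then `Φ P = Mx` and `Φ N = Mx`. -/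
theorem eq_max_of_sq_le {ΦA ΦP ΦN Mx : ℝ} (hMx : 0 < Mx) (hA : ΦA = Mx) (hP : ΦP ≤ Mx) (hN : ΦN ≤ Mx)
    (hP0 : 0 ≤ ΦP) (hN0 : 0 ≤ ΦN) (hsq : ΦA ^ 2 ≤ ΦP * ΦN) : ΦP = Mx ∧ ΦN = Mx := by
  subst hA
  constructor
  · by_contra h
    have hlt : ΦP < ΦA := lt_of_le_of_ne hP h
    nlinarith [mul_le_mul_of_nonneg_left hN hP0]
  · by_contra h
    have hlt : ΦN < ΦA := lt_of_le_of_ne hN h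
    nlinarith [mul_le_mul_of_nonneg_right hP hN0]

/-- **Maximality propagates along a reachability chain down to `∅`.**  If `Φ ≤ Mx` on the good configurations, the good
class is closed under both symmetrisations at valid moves, the card identity and the Cauchy–Schwarz inequality hold there,
then a good maximiser from which `∅` is reachable forces `Φ ∅ = Mx`. -/
theorem phi_empty_eq_of_reaches {p : Finset α → ℝ} {lam : ℝ} (hlam : 0 < lam)
    {Good : Finset α → Prop} {valid : μ → Finset α → Prop} {sP sM : μ → Finset α → Finset α}
    (h0 : ∀ A, Good A → 0 ≤ p A)
    (hgoodP : ∀ A m, Good A → valid m A → Good (sP m A))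
    (hgoodM : ∀ A m, Good A → valid m A → Good (sM m A))
    (hcard : ∀ A m, Good A → valid m A → #(sP m A) + #(sM m A) = 2 * #A)
    (hcs : ∀ A m, Good A → valid m A → p A ^ 2 ≤ p (sP m A) * p (sM m A))
    {Mx : ℝ} (hMx : 0 < Mx) (hmax : ∀ A, Good A → phi p lam A ≤ Mx)
    {A : Finset α} (hreach : Reaches valid sP sM A) (hA : Good A) (hΦ : phi p lam A = Mx) :
    phi p lam ∅ = Mx := by
  induction hreach with
  | empty => exact hΦ
  | @plus B m hv _ ih =>
    have hsq := phi_sq_le hlam (hcs B m hA hv) (hcard B m hA hv)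
    have h := eq_max_of_sq_le hMx hΦ (hmax _ (hgoodP B m hA hv)) (hmax _ (hgoodM B m hA hv))
      (phi_nonneg hlam (h0 _ (hgoodP B m hA hv))) (phi_nonneg hlam (h0 _ (hgoodM B m hA hv))) hsq
    exact ih (hgoodP B m hA hv) h.1
  | @minus B m hv _ ih =>
    have hsq := phi_sq_le hlam (hcs B m hA hv) (hcard B m hA hv)
    have h := eq_max_of_sq_le hMx hΦ (hmax _ (hgoodP B m hA hv)) (hmax _ (hgoodM B m hA hv))
      (phi_nonneg hlam (h0 _ (hgoodP B m hA hv))) (phi_nonneg hlam (h0 _ (hgoodM B m hA hv))) hsq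
    exact ih (hgoodM B m hA hv) h.2

/-- **The extremal reduction** (Fröhlich–Israel–Lieb–Simon maximisation, abstract form).  On a finite type: if `p ≥ 0` on
the good configurations, `p ∅ ≤ 1`, the good class contains `∅` and is closed under both symmetrisations at valid moves,
the card identity `#sP + #sM = 2#` and the Cauchy–Schwarz inequality hold there, `p D ≤ λ ^ #D` on the dense good
configurations (`λ > 0`), and every non-empty good configuration that is not dense REACHES `∅`, then `p A ≤ λ ^ #A` for
every good `A`. -/
theorem le_pow_card_of_reaches [Fintype α] {p : Finset α → ℝ} {lam : ℝ} (hlam : 0 < lam)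
    {Good Dense : Finset α → Prop} {valid : μ → Finset α → Prop} {sP sM : μ → Finset α → Finset α}
    (h0 : ∀ A, Good A → 0 ≤ p A) (hempty : p ∅ ≤ 1) (hgood0 : Good ∅)
    (hgoodP : ∀ A m, Good A → valid m A → Good (sP m A))
    (hgoodM : ∀ A m, Good A → valid m A → Good (sM m A))
    (hcard : ∀ A m, Good A → valid m A → #(sP m A) + #(sM m A) = 2 * #A)
    (hcs : ∀ A m, Good A → valid m A → p A ^ 2 ≤ p (sP m A) * p (sM m A))
    (hdense : ∀ D, Good D → Dense D → p D ≤ lam ^ #D)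
    (hreach : ∀ A, Good A → A.Nonempty → ¬ Dense A → Reaches valid sP sM A)
    {A : Finset α} (hA : Good A) : p A ≤ lam ^ #A := by
  classical
  set 𝒢 : Finset (Finset α) := (univ : Finset (Finset α)).filter Good with h𝒢
  have hmem : ∀ B, B ∈ 𝒢 ↔ Good B := fun B => by simp [h𝒢]
  obtain ⟨Amax, hAmax𝒢, hAmax⟩ := exists_max_image 𝒢 (phi p lam) ⟨∅, (hmem ∅).2 hgood0⟩
  have hgoodmax : Good Amax := (hmem _).1 hAmax𝒢
  set Mx := phi p lam Amax with hMxdef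
  have hmax : ∀ B, Good B → phi p lam B ≤ Mx := fun B hB => hAmax B ((hmem B).2 hB)
  -- it suffices to show `Mx ≤ 1`
  suffices hMx1 : Mx ≤ 1 by
    have h := (hmax A hA).trans hMx1
    rwa [phi, div_le_one (pow_pos hlam _)] at h
  by_cases hpos : Mx ≤ 0
  · exact hpos.trans zero_le_one
  have hMx : 0 < Mx := lt_of_not_ge hpos
  by_cases hD : Dense Amax
  · -- a dense maximiser: `Φ ≤ 1` there
    have h := hdense Amax hgoodmax hD
    show phi p lam Amax ≤ 1
    rwa [phi, div_le_one (pow_pos hlam _)]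
  by_cases hne : Amax = ∅
  · show phi p lam Amax ≤ 1
    rw [hne, phi_empty]; exact hempty
  · have hreachA := hreach Amax hgoodmax (nonempty_iff_ne_empty.2 hne) hD
    have h := phi_empty_eq_of_reaches hlam h0 hgoodP hgoodM hcard hcs hMx hmax hreachA hgoodmax rfl
    rw [← h, phi_empty]; exact hempty

end Abstract


/-! ## §2 The odd cycle `ℤ/(2S+1)`: slabs, closed halves, valid reflections, symmetrisations -/

section OddCycle

variable {S w : ℕ}

/-- Value of a difference of two small naturals in `ℤ/(2S+1)`. -/
private theorem val_natCast_sub_natCast {a b : ℕ} (ha : a < 2 * S + 1) (hb : b < 2 * S + 1) :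
    ((a : ZMod (2 * S + 1)) - (b : ZMod (2 * S + 1))).val =
      if b ≤ a then a - b else a + (2 * S + 1) - b := by
  split_ifs with h
  · rw [← Nat.cast_sub h, ZMod.val_cast_of_lt (by omega)]
  · have : (a : ZMod (2 * S + 1)) - (b : ZMod (2 * S + 1)) = ((a + (2 * S + 1) - b : ℕ) : ZMod _) := by
      rw [sub_eq_iff_eq_add, ← Nat.cast_add, Nat.sub_add_cancel (by omega), Nat.cast_add,
        ZMod.natCast_self, add_zero]
    rw [this, ZMod.val_cast_of_lt (by omega)]

/-- **Differences through a base point**: `(b − a).val` in terms of the offsets `(a − x).val`, `(b − x).val`. -/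
theorem val_sub_eq_offsets (x a b : ZMod (2 * S + 1)) :
    (b - a).val = if (a - x).val ≤ (b - x).val then (b - x).val - (a - x).val
      else (b - x).val + (2 * S + 1) - (a - x).val := by
  have h : b - a = ((b - x).val : ZMod (2 * S + 1)) - ((a - x).val : ZMod (2 * S + 1)) := by
    rw [ZMod.natCast_zmod_val, ZMod.natCast_zmod_val]; ring
  rw [h]
  exact val_natCast_sub_natCast (ZMod.val_lt _) (ZMod.val_lt _)

/-- **The slab starting at `a` (layers `a, …, a+w−1`) lies in the closed positive half `[x, x+S]`** of the reflection
fixing the site hyperplane `x` and the link hyperplane `(x+S, x+S+1)`: offset `(a − x).val + w − 1 ≤ S`. -/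
abbrev InPlus (w : ℕ) (x a : ZMod (2 * S + 1)) : Prop := (a - x).val + w ≤ S + 1

/-- **The slab starting at `a` lies in the closed negative half `[x+S+1, x+2S+1] = [x+S+1, x]`.** -/
abbrev InMinus (w : ℕ) (x a : ZMod (2 * S + 1)) : Prop := S + 1 ≤ (a - x).val ∧ (a - x).val + w ≤ 2 * S + 2

/-- **Valid reflection for a configuration**: every slab of `A` lies in one of the two closed halves of `x`, i.e. no
slab is cut by the site hyperplane `x` or by the link hyperplane `(x+S, x+S+1)` — the reflections of an odd torus for
which the Osterwalder–Seiler / reflection Cauchy–Schwarz inequality applies to products of slab observables. -/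
def Valid (w : ℕ) (x : ZMod (2 * S + 1)) (A : Finset (ZMod (2 * S + 1))) : Prop :=
  ∀ a ∈ A, InPlus w x a ∨ InMinus w x a

/-- **The mirror slab**: the reflection `y ↦ 2x − y` carries the slab `[a, a+w−1]` to `[2x+1−w−a, 2x−a]`, whose start
is `refl w x a = 2x + 1 − w − a`. -/
def refl (w : ℕ) (x a : ZMod (2 * S + 1)) : ZMod (2 * S + 1) := 2 * x + 1 - (w : ZMod (2 * S + 1)) - a

/-- **Closed positive symmetrisation**: the slabs of `A` in the closed positive half together with their mirrors. -/
def symP (w : ℕ) (x : ZMod (2 * S + 1)) (A : Finset (ZMod (2 * S + 1))) : Finset (ZMod (2 * S + 1)) :=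
  A.filter (InPlus w x) ∪ (A.filter (InPlus w x)).image (refl w x)

/-- **Closed negative symmetrisation**: the other slabs of `A` together with their mirrors. -/
def symM (w : ℕ) (x : ZMod (2 * S + 1)) (A : Finset (ZMod (2 * S + 1))) : Finset (ZMod (2 * S + 1)) :=
  A.filter (fun a => ¬ InPlus w x a) ∪ (A.filter (fun a => ¬ InPlus w x a)).image (refl w x)

/-- **Compatible configuration**: two distinct slabs are disjoint or share exactly one boundary layer, i.e. their starts
are at cyclic distance `≥ w − 1` in both directions. -/
def Compatible (w : ℕ) (A : Finset (ZMod (2 * S + 1))) : Prop :=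
  ∀ a ∈ A, ∀ b ∈ A, a ≠ b → w - 1 ≤ (b - a).val

/-- `refl` is an involution. -/
theorem refl_refl (w : ℕ) (x a : ZMod (2 * S + 1)) : refl w x (refl w x a) = a := by
  unfold refl; ring

/-- `refl` is injective. -/
theorem refl_injective (w : ℕ) (x : ZMod (2 * S + 1)) : Function.Injective (refl w x) := fun a b h => by
  simpa [refl_refl] using congrArg (refl w x) h

/-- `refl` reverses differences: `refl b − refl a = a − b`. -/
theorem refl_sub_refl (w : ℕ) (x a b : ZMod (2 * S + 1)) : refl w x b - refl w x a = a - b := by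
  unfold refl; ring

/-- **Offset of the mirror slab**: if the slab at `a` fits below `x + 2S + 2 − w` (in particular if it lies in a
closed half) then `(refl w x a − x).val = 2S + 2 − w − (a − x).val` (`w ≥ 2`). -/
theorem val_refl_sub (hw : 2 ≤ w) {x a : ZMod (2 * S + 1)}
    (h : (a - x).val + w ≤ 2 * S + 2) : (refl w x a - x).val = 2 * S + 2 - w - (a - x).val := by
  have hu := ZMod.val_lt (a - x)
  have hcast : refl w x a - x = ((2 * S + 2 - w - (a - x).val : ℕ) : ZMod (2 * S + 1)) := by
    have h1 : ((2 * S + 2 - w - (a - x).val : ℕ) : ZMod (2 * S + 1)) + ((w + (a - x).val : ℕ) : ZMod _) =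
        ((2 * S + 1 : ℕ) : ZMod (2 * S + 1)) + 1 := by
      rw [← Nat.cast_add, show 2 * S + 2 - w - (a - x).val + (w + (a - x).val) = (2 * S + 1) + 1 by omega]
      push_cast; ring
    rw [ZMod.natCast_self, zero_add, Nat.cast_add, ZMod.natCast_zmod_val] at h1
    have h2 : ((2 * S + 2 - w - (a - x).val : ℕ) : ZMod (2 * S + 1)) = 1 - (w : ZMod _) - (a - x) := by
      rw [← h1]; ring
    rw [h2, refl]; ring
  rw [hcast, ZMod.val_cast_of_lt (by omega)]

/-- A slab in the closed positive half has its mirror in the closed negative half (`w ≥ 2`). -/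
theorem inMinus_refl_of_inPlus (hw : 2 ≤ w) {x a : ZMod (2 * S + 1)} (h : InPlus w x a) :
    InMinus w x (refl w x a) := by
  have hv := val_refl_sub hw (x := x) (a := a) (by unfold InPlus at h; omega)
  unfold InPlus at h; unfold InMinus; omega

/-- A slab in the closed negative half has its mirror in the closed positive half (`w ≥ 2`). -/
theorem inPlus_refl_of_inMinus (hw : 2 ≤ w) {x a : ZMod (2 * S + 1)} (h : InMinus w x a) :
    InPlus w x (refl w x a) := by
  have hv := val_refl_sub hw (x := x) (a := a) (by unfold InMinus at h; omega)
  unfold InMinus at h; unfold InPlus; omega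

/-- The two closed halves share no slab of width `w ≥ 1`. -/
theorem not_inPlus_of_inMinus (hw : 1 ≤ w) {x a : ZMod (2 * S + 1)} (h : InMinus w x a) : ¬ InPlus w x a := by
  unfold InMinus at h; unfold InPlus; omega

/-- **Card identity**: `#(symP w x A) + #(symM w x A) = 2 · #A` at a valid reflection (`w ≥ 2`). -/
theorem card_symP_add_card_symM (hw : 2 ≤ w) {x : ZMod (2 * S + 1)} {A : Finset (ZMod (2 * S + 1))}
    (hv : Valid w x A) : #(symP w x A) + #(symM w x A) = 2 * #A := by
  classical
  have hdisjP : Disjoint (A.filter (InPlus w x)) ((A.filter (InPlus w x)).image (refl w x)) := by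
    rw [disjoint_left]
    intro c hc hc'
    obtain ⟨b, hb, rfl⟩ := mem_image.1 hc'
    exact not_inPlus_of_inMinus (by omega) (inMinus_refl_of_inPlus hw (mem_filter.1 hb).2) (mem_filter.1 hc).2
  have hdisjM : Disjoint (A.filter (fun a => ¬ InPlus w x a))
      ((A.filter (fun a => ¬ InPlus w x a)).image (refl w x)) := by
    rw [disjoint_left]
    intro c hc hc'
    obtain ⟨b, hb, rfl⟩ := mem_image.1 hc'
    have hbm : InMinus w x b := ((hv b (mem_filter.1 hb).1).resolve_left (mem_filter.1 hb).2)
    exact (mem_filter.1 hc).2 (inPlus_refl_of_inMinus hw hbm)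
  rw [symP, symM, card_union_of_disjoint hdisjP, card_union_of_disjoint hdisjM,
    card_image_of_injective _ (refl_injective w x), card_image_of_injective _ (refl_injective w x),
    ← card_filter_add_card_filter_not (s := A) (InPlus w x)]
  ring

/-- **The positive symmetrisation of a compatible configuration at a valid reflection is compatible** (`w ≥ 2`). -/
theorem compatible_symP (hw : 2 ≤ w) {x : ZMod (2 * S + 1)} {A : Finset (ZMod (2 * S + 1))}
    (hA : Compatible w A) : Compatible w (symP w x A) := by
  classical
  intro a ha b hb hab
  rw [symP, mem_union, mem_filter, mem_image] at ha hb
  -- the four cases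
  rcases ha with ⟨haA, hap⟩ | ⟨a', ha', rfl⟩ <;> rcases hb with ⟨hbA, hbp⟩ | ⟨b', hb', rfl⟩
  · exact hA a haA b hbA hab
  · -- `a` original in the positive half, `b = refl b'`
    have hb'p : InPlus w x b' := (mem_filter.1 hb').2
    have hvb := val_refl_sub hw (x := x) (a := b') (by unfold InPlus at hb'p; omega)
    rw [val_sub_eq_offsets x]
    unfold InPlus at hap hb'p
    split_ifs with h <;> omega
  · have ha'p : InPlus w x a' := (mem_filter.1 ha').2
    have hva := val_refl_sub hw (x := x) (a := a') (by unfold InPlus at ha'p; omega)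
    rw [val_sub_eq_offsets x]
    unfold InPlus at hbp ha'p
    split_ifs with h <;> omega
  · rw [refl_sub_refl]
    exact hA b' (mem_filter.1 hb').1 a' (mem_filter.1 ha').1 fun h => hab (by rw [h])

/-- **The negative symmetrisation of a compatible configuration at a valid reflection is compatible** (`w ≥ 2`). -/
theorem compatible_symM (hw : 2 ≤ w) {x : ZMod (2 * S + 1)} {A : Finset (ZMod (2 * S + 1))}
    (hA : Compatible w A) (hv : Valid w x A) : Compatible w (symM w x A) := by
  classical
  intro a ha b hb hab
  rw [symM, mem_union, mem_filter, mem_image] at ha hb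
  rcases ha with ⟨haA, hap⟩ | ⟨a', ha', rfl⟩ <;> rcases hb with ⟨hbA, hbp⟩ | ⟨b', hb', rfl⟩
  · exact hA a haA b hbA hab
  · have ham : InMinus w x a := (hv a haA).resolve_left hap
    have hb'm : InMinus w x b' := (hv b' (mem_filter.1 hb').1).resolve_left (mem_filter.1 hb').2
    have hvb := val_refl_sub hw (x := x) (a := b') (by unfold InMinus at hb'm; omega)
    rw [val_sub_eq_offsets x]
    unfold InMinus at ham hb'm
    split_ifs with h <;> omega
  · have hbm : InMinus w x b := (hv b hbA).resolve_left hbp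
    have ha'm : InMinus w x a' := (hv a' (mem_filter.1 ha').1).resolve_left (mem_filter.1 ha').2
    have hva := val_refl_sub hw (x := x) (a := a') (by unfold InMinus at ha'm; omega)
    rw [val_sub_eq_offsets x]
    unfold InMinus at hbm ha'm
    split_ifs with h <;> omega
  · rw [refl_sub_refl]
    exact hA b' (mem_filter.1 hb').1 a' (mem_filter.1 ha').1 fun h => hab (by rw [h])

/-- **A configuration inside one closed positive half reaches `∅` in one move**: the reflection is valid and its
negative symmetrisation is empty. -/
theorem reaches_of_forall_inPlus (w : ℕ) {x : ZMod (2 * S + 1)} {A : Finset (ZMod (2 * S + 1))}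
    (h : ∀ a ∈ A, InPlus w x a) : Reaches (Valid w) (symP w) (symM w) A := by
  classical
  have hv : Valid w x A := fun a ha => Or.inl (h a ha)
  have he : symM w x A = ∅ := by
    have hf : A.filter (fun a => ¬ InPlus w x a) = ∅ :=
      filter_eq_empty_iff.2 fun a ha hna => hna (h a ha)
    rw [symM, hf, image_empty, union_empty]
  exact Reaches.minus x hv (by rw [he]; exact Reaches.empty)

/-- **The chessboard bound on the odd cycle, given reachability** (FILS maximisation, no block divisibility): let
`w ≥ 2`, `p ≥ 0` on compatible configurations of slabs of width `w` on `ℤ/(2S+1)`, `p ∅ ≤ 1`, and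
`p A ^ 2 ≤ p (symP w x A) · p (symM w x A)` for every compatible `A` and every VALID reflection `x` (reflection
Cauchy–Schwarz with closed halves); if `p D ≤ λ ^ #D` on the dense compatible configurations (`λ > 0`) and every
non-empty compatible configuration that is not dense reaches `∅`, then `p A ≤ λ ^ #A` for EVERY compatible `A`. -/
theorem le_pow_card_oddCycle_of_reaches {w : ℕ} (hw : 2 ≤ w) {p : Finset (ZMod (2 * S + 1)) → ℝ} {lam : ℝ}
    (hlam : 0 < lam) (h0 : ∀ A, Compatible w A → 0 ≤ p A) (hempty : p ∅ ≤ 1)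
    (hcs : ∀ A x, Compatible w A → Valid w x A → p A ^ 2 ≤ p (symP w x A) * p (symM w x A))
    {Dense : Finset (ZMod (2 * S + 1)) → Prop} (hdense : ∀ D, Compatible w D → Dense D → p D ≤ lam ^ #D)
    (hreach : ∀ A, Compatible w A → A.Nonempty → ¬ Dense A → Reaches (Valid w) (symP w) (symM w) A)
    {A : Finset (ZMod (2 * S + 1))} (hA : Compatible w A) : p A ≤ lam ^ #A :=
  le_pow_card_of_reaches (μ := ZMod (2 * S + 1)) (valid := Valid w) (sP := symP w) (sM := symM w) hlam h0 hempty
    (fun a ha => by simp at ha) (fun A x hA _ => compatible_symP hw hA) (fun A x hA hv => compatible_symM hw hA hv)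
    (fun A x _ hv => card_symP_add_card_symM hw hv) (fun A x hA hv => hcs A x hA hv) hdense hreach hA

end OddCycle

end Summit.QuantumFields.YangMills.Theorems.OddCycleChessboard
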